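import Literature.AlgebraicGeometry.Resolution.BlowupStalkLocalBlowupAlong
import Literature.AlgebraicGeometry.Resolution.EmbeddedResolutionExcellentSurfaces
import Literature.AlgebraicGeometry.Resolution.RegularCentreRsopPart
import Literature.AlgebraicGeometry.Resolution.RegularBlowup
import Literature.AlgebraicGeometry.Resolution.NormalCrossingsBlowupStepReduction
import Literature.AlgebraicGeometry.Resolution.BlowupsIntegral
import Literature.AlgebraicGeometry.Resolution.BlowupsProperProofs
import Literature.AlgebraicGeometry.Resolution.ProjectiveSpaceRegular
import Summits.ResolutionOfSingularities.ResolutionOfSingularities.Theorems.RadicialJungCleanModelsNSZeroLocusStalk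
import HarnessLib

/-!
# Scheme-to-local extraction of a sequence of blow-ups in regular centres along a valuation (chain of coordinate local blowing ups)

Route `RadicialJung`, crux `CleanModels` (stmt-ResolutionOfSingularities-15917), registered skeleton `Cruxes/CleanModels/Lines/Sketch.lean`
rev 35 (sha16 de44649d8f729c3b), stub 7 `stub_cleanModelsDimGEFour`.  Explicit-unit seat `decomp-res-hand-2` g6 (structural hand): the
INDUCTION brick of the residue-side DRIVER `CossartJannsenSaito2020Embedded → ResidueChains` (spec `Lines/Sketch_hand2_g5_NS32_assembly_spec.lean`
rev 4), the one remaining non-kernel input of ✓ `localMonomialization_four_of_rankOne_of_residueChains`.  OURS; structural bookkeeping, counted 0;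
nothing here proves resolution of singularities in characteristic `p`.

`chain_of_isEmbeddedTransform` — let `S ⊆ Ō ⊆ F` be a regular local subring of a field dominated by a valuation ring `Ō` (`locAtCentre S Ō = S`),
`0 ≠ f ∈ S`, and `σ : Z' → Spec S` a composite of blow-ups in regular centres lying over `V(f)` (the tree's `IsEmbeddedTransform`, e.g. the
output of CJS 2020 Thm. 1.4).  Then `Z'` is integral, locally Noetherian and regular, and SOME point `x ∈ Z'` carries an embedding
`ψ : 𝒪_{Z',x} ↪ F`, compatible with `S ⊆ F`, whose image is the last ring of a CHAIN OF COORDINATE LOCAL BLOWING UPS of `S` along `Ō`: rings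
`S = Sq 0, …, Sq n ⊆ Ō` dominated by `Ō`, `Sq (i+1)` the `Ō`-local ring of `Sq i [z_l / z₀ : l]` for a family `(z₀, …, z_s)` that is PART OF A
REGULAR SYSTEM OF PARAMETERS of `Sq i` with `z₀` of minimal `ν̄`-value (positive), and `f ∈ z₀ · Sq (i+1)` at every step (the centres lie over
`V(f)`).  This is the format consumed by ✓ `chainTransport_of_isRsopPart` (`…NSChainTransport.lean`).  Proof: induction over `IsEmbeddedTransform`;
the step is the general-centre blow-up/valuation dictionary ✓ `IsBlowup.exists_point_range_eq_locAtCentre_closure` (`BlowupStalkLocalBlowupAlong.lean`)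
at a regular centre (✓ `exists_isRsopPart_span_range_eq_stalkIdeal`), with ✓ `germ_appTop_mem_stalkIdeal_of_isRadical` for `f ∈ (z)`.
[cite: CossartJannsenSaito2020, Thm. 1.4 with (6.2)] [cite: NovacoskiSpivakovsky2014, Def. 2.11] [cite: StacksProject, Tag 0804]
-/

noncomputable section

set_option linter.dupNamespace false -- mandated namespace of this single-conjunct summit

open IsLocalRing AlgebraicGeometry CategoryTheory TopologicalSpace
open Literature.AlgebraicGeometry.Resolution

namespace Summit.ResolutionOfSingularities.ResolutionOfSingularities.Theorems.RadicialJung.CleanModels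

universe u

open Scheme.IdealSheafData

variable {F : Type u} [Field F]

/-- The subring generated by `B` and the quotients `c_i / c_j` over ALL indices `i` equals the one generated by `B` and the quotients over
`i ≠ j`, after moving `j` to the front: `closure (B ∪ {c i / c j : i}) = closure (B ∪ {(c ∘ e) l.succ / (c ∘ e) 0 : l})` for any
permutation `e` with `e 0 = j` (the extra generator `c_j / c_j = 1` is redundant). [folklore] -/
theorem closure_union_range_div_eq_of_equiv (B : Subring F) {m : ℕ} (c : Fin (m + 1) → F) (e : Fin (m + 1) ≃ Fin (m + 1))
    (hc0 : c (e 0) ≠ 0) :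
    Subring.closure ((B : Set F) ∪ Set.range fun i => c i / c (e 0)) =
      Subring.closure ((B : Set F) ∪ Set.range fun l : Fin m => (c ∘ e) l.succ / (c ∘ e) 0) := by
  apply le_antisymm
  · rw [Subring.closure_le]
    rintro z (hz | ⟨i, rfl⟩)
    · exact Subring.subset_closure (Or.inl hz)
    · -- `i = e k` for some `k`; `k = 0` gives `1`, `k = l.succ` a generator
      obtain ⟨k, rfl⟩ := e.surjective i
      refine Fin.cases ?_ (fun l => ?_) k
      · change c (e 0) / c (e 0) ∈ _
        rw [div_self hc0]
        exact Subring.one_mem _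
      · exact Subring.subset_closure (Or.inr ⟨l, rfl⟩)
  · rw [Subring.closure_le]
    rintro z (hz | ⟨l, rfl⟩)
    · exact Subring.subset_closure (Or.inl hz)
    · exact Subring.subset_closure (Or.inr ⟨e l.succ, rfl⟩)

/-- **Scheme-to-local extraction of a sequence of blow-ups in regular centres along a valuation.**  See the module docstring.
[cite: CossartJannsenSaito2020, Thm. 1.4 with (6.2)] [cite: NovacoskiSpivakovsky2014, Def. 2.11] [cite: StacksProject, Tag 0804] -/
theorem chain_of_isEmbeddedTransform (Ō : ValuationSubring F) (S : Subring F) [IsLocalRing S]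
    (hSŌ : S ≤ Ō.toSubring) (hSdom : locAtCentre S Ō = S) (hSreg : IsRegularLocalRing S)
    (f : F) (hfS : f ∈ S) (hf0 : f ≠ 0) (Y : Set (Spec (.of S)))
    {Z' : Scheme.{u}} {σ : Z' ⟶ Spec (.of S)} {Y' : Set Z'}
    (h : IsEmbeddedTransform Y {p : Spec (.of S) | (⟨f, hfS⟩ : S) ∈ (p : PrimeSpectrum S).asIdeal} σ Y') :
    IsIntegral Z' ∧ IsLocallyNoetherian Z' ∧ Scheme.IsRegular Z' ∧
    ∃ (x : Z') (ψ : Z'.presheaf.stalk x →+* F), Function.Injective ψ ∧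
      (∀ g : S, ψ (Z'.presheaf.germ ⊤ x trivial (σ.appTop ((Scheme.ΓSpecIso (.of S)).inv g))) = (g : F)) ∧
      ∃ (n : ℕ) (Sq : ℕ → Subring F) (s : ℕ → ℕ) (zb : ℕ → ℕ → F),
        Sq 0 = S ∧ ψ.range = Sq n ∧
        (∀ i ≤ n, Sq i ≤ Ō.toSubring ∧ locAtCentre (Sq i) Ō = Sq i) ∧
        (∀ i < n, ∃ (_ : IsLocalRing (Sq i)) (c : Fin (s i + 1) → Sq i), IsRsopPart c ∧ ∀ j, (c j : F) = zb i j) ∧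
        (∀ i < n, Ō.valuation (zb i 0) < 1) ∧
        (∀ i < n, ∀ j ≤ s i, Ō.valuation (zb i j) ≤ Ō.valuation (zb i 0)) ∧
        (∀ i < n, Sq (i + 1) =
          locAtCentre (Subring.closure ((Sq i : Set F) ∪ Set.range fun l : Fin (s i) => zb i l.succ / zb i 0)) Ō) ∧
        (∀ i < n, f / zb i 0 ∈ Sq (i + 1)) := by
  classical
  haveI := hSreg
  haveI : IsDomain (CommRingCat.of S) := inferInstanceAs (IsDomain S)
  haveI : IsNoetherianRing (CommRingCat.of S) := inferInstanceAs (IsNoetherianRing S)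
  haveI : IsRegularRing (CommRingCat.of S) := isRegularRing_of_isRegularLocalRing S
  induction h with
  | refl =>
    refine ⟨inferInstance, inferInstance, Scheme.isRegular_Spec (.of S), closedPoint S,
      S.subtype.comp (stalkClosedPointIso (.of S)).hom.hom, ?_, ?_, 0, fun _ => S, fun _ => 0, fun _ _ => 0,
      rfl, ?_, ?_, ?_, ?_, ?_, ?_, ?_⟩
    · exact S.subtype_injective.comp (ConcreteCategory.bijective_of_isIso (stalkClosedPointIso (.of S)).hom).1
    · intro g
      rw [Scheme.Hom.id_appTop]
      change ((((Spec (.of S)).presheaf.germ ⊤ (closedPoint S) trivial ≫ (stalkClosedPointIso (.of S)).hom)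
        ((Scheme.ΓSpecIso (.of S)).inv g) : S) : F) = g
      rw [germ_stalkClosedPointIso_hom, ← CategoryTheory.comp_apply, Iso.inv_hom_id]
      rfl
    · rw [← RingHom.map_range, RingHom.range_eq_top_of_surjective _
        (ConcreteCategory.bijective_of_isIso (stalkClosedPointIso (.of S)).hom).2, ← RingHom.range_eq_map]
      exact Subring.range_subtype S
    · intro i _; exact ⟨hSŌ, hSdom⟩
    · intro i hi; exact absurd hi (Nat.not_lt_zero i)
    · intro i hi; exact absurd hi (Nat.not_lt_zero i)
    · intro i hi; exact absurd hi (Nat.not_lt_zero i)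
    · intro i hi; exact absurd hi (Nat.not_lt_zero i)
    · intro i hi; exact absurd hi (Nat.not_lt_zero i)
  | @blowup Z' Z'' σ Y' h C τ hτ hC hT ih =>
    obtain ⟨hint, hnoeth, hreg, x, ψ, hψ, hcompat, n, Sq, s, zb, hS0, hrange, hdomi, hrsop, hzb0, hmin, hstep, hf⟩ := ih
    haveI := hint
    haveI := hnoeth
    haveI : IsRegularLocalRing (Z'.presheaf.stalk x) := hreg x
    -- the image `Sq n` of `ψ` lies in `Ō` and is dominated by it
    have hSqn : Sq n ≤ Ō.toSubring ∧ locAtCentre (Sq n) Ō = Sq n := hdomi n le_rfl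
    have hRO : ∀ r, ψ r ∈ Ō := fun r => hSqn.1 (hrange ▸ ⟨r, rfl⟩)
    have hrange' : ψ.range = locAtCentre (Sq n) Ō := by rw [hSqn.2]; exact hrange
    have hdom : ∀ r ∈ maximalIdeal (Z'.presheaf.stalk x), Ō.valuation (ψ r) < 1 := fun r hr =>
      (mem_maximalIdeal_iff_of_range_eq_locAtCentre Ō ψ hψ hSqn.1 hrange' r).mp hr
    -- `ψ` extended to the function field
    let Φ : Z'.functionField →+* F := IsFractionRing.lift hψ
    have hΦψ : Φ.comp (algebraMap (Z'.presheaf.stalk x) Z'.functionField) = ψ :=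
      RingHom.ext fun a => IsFractionRing.lift_algebraMap hψ a
    -- the germ of `f`
    set fg : Z'.presheaf.stalk x := Z'.presheaf.germ ⊤ x trivial (σ.appTop ((Scheme.ΓSpecIso (.of S)).inv ⟨f, hfS⟩)) with hfgdef
    have hψfg : ψ fg = f := hcompat ⟨f, hfS⟩
    have hfg0 : fg ≠ 0 := fun h0 => hf0 (by rw [← hψfg, h0, map_zero])
    -- compatibility of the new embedding with `S ⊆ F`, for any point `x''` over `x`
    have hcompat'' : ∀ (x'' : Z'') (hx'' : τ x'' = x) (g : S),
        (Φ.comp (hτ.stalkEmb x'')) (Z''.presheaf.germ ⊤ x'' trivial ((τ ≫ σ).appTop ((Scheme.ΓSpecIso (.of S)).inv g))) = (g : F) := by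
      intro x'' hx'' g
      subst hx''
      rw [Scheme.Hom.comp_appTop, CategoryTheory.comp_apply]
      change Φ (hτ.stalkEmb x'' (Z''.presheaf.germ (τ ⁻¹ᵁ ⊤) x'' trivial (τ.app ⊤ (σ.appTop ((Scheme.ΓSpecIso (.of S)).inv g))))) = _
      rw [← Scheme.Hom.germ_stalkMap_apply, hτ.stalkEmb_stalkMap, ← hcompat g, ← hΦψ]
      rfl
    by_cases hxC : x ∈ C.support
    · /- ON THE CENTRE: `C_x = (c)` for part of a regular system of parameters `c`, containing the germ of `f` -/
      obtain ⟨r, c, hc, hcspan⟩ := exists_isRsopPart_span_range_eq_stalkIdeal hC hxC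
      have hfgC : fg ∈ Ideal.span (Set.range c) := by
        rw [hcspan]
        exact germ_appTop_mem_stalkIdeal_of_isRadical σ (⟨f, hfS⟩ : S) C hT
          (hcspan ▸ (hc.isPrime_span_range).isRadical)
      -- `r ≥ 1` since `f ≠ 0`
      have hr0 : r ≠ 0 := by
        rintro rfl
        rw [Set.range_eq_empty c, Ideal.span_empty, Ideal.mem_bot] at hfgC
        exact hfg0 hfgC
      obtain ⟨r', rfl⟩ : ∃ r', r = r' + 1 := Nat.exists_eq_add_one_of_ne_zero hr0
      -- the generator of maximal value, moved to the front
      obtain ⟨j, hj⟩ := Finite.exists_max fun i => Ō.valuation (ψ (c i))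
      let e : Fin (r' + 1) ≃ Fin (r' + 1) := Equiv.swap 0 j
      let c' : Fin (r' + 1) → Z'.presheaf.stalk x := c ∘ e
      have hc' : IsRsopPart c' := hc.comp_equiv e
      have he0 : e 0 = j := Equiv.swap_apply_left 0 j
      have hc'0 : c' 0 = c j := by change c (e 0) = c j; rw [he0]
      have hc'span : Ideal.span (Set.range c') = stalkIdeal C x := by
        rw [← hcspan, Set.range_comp, e.surjective.range_eq, Set.image_univ]
      have hθ : ψ (c' 0) ≠ 0 := fun h0 => hc'.ne_zero 0 (hψ (by rw [h0, map_zero]))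
      have hmin' : ∀ i, Ō.valuation (ψ (c' i)) ≤ Ō.valuation (ψ (c' 0)) := fun i => by
        rw [hc'0]; exact hj (e i)
      -- THE DICTIONARY
      obtain ⟨x'', hx'', hrange''⟩ := hτ.exists_point_range_eq_locAtCentre_closure Ō x c' hc'span 0 Φ ψ hΦψ hRO hdom hθ hmin'
      -- `C ≠ ⊥` (its stalk at `x` contains the non-zero germ of `f`), so `Z''` is integral, locally Noetherian and regular
      have hCne : C ≠ ⊥ := by
        intro hC0
        obtain ⟨U, hU, hxU, -⟩ := exists_isAffineOpen_mem_and_subset (X := Z') (x := x) (U := ⊤) (Opens.mem_top x)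
        have h1 : stalkIdeal C x = ⊥ := by
          rw [stalkIdeal_eq_map_germ C ⟨U, hU⟩ hxU, hC0]
          simp
        have h2 : fg ∈ stalkIdeal C x := hcspan ▸ hfgC
        rw [h1, Ideal.mem_bot] at h2
        exact hfg0 h2
      haveI hint'' : IsIntegral Z'' := hτ.isIntegral hCne
      haveI : IsProper τ := hτ.isProper
      have hnoeth'' : IsLocallyNoetherian Z'' := LocallyOfFiniteType.isLocallyNoetherian τ
      have hreg'' : Scheme.IsRegular Z'' := hτ.isRegular_of_isRegular_subscheme hreg hC
      -- the new ring of the chain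
      set T : Subring F := Subring.closure ((Sq n : Set F) ∪ Set.range fun i => ψ (c' i) / ψ (c' 0)) with hTdef
      have hTeq : T = Subring.closure ((Sq n : Set F) ∪ Set.range fun l : Fin r' => ψ (c' l.succ) / ψ (c' 0)) := by
        rw [hTdef]
        exact closure_union_range_div_eq_of_equiv (Sq n) (ψ ∘ c') (Equiv.refl _) hθ
      have hTŌ : T ≤ Ō.toSubring := by
        rw [hTdef, Subring.closure_le]
        rintro z (hz | ⟨i, rfl⟩)
        · exact hSqn.1 hz
        · change ψ (c' i) / ψ (c' 0) ∈ Ō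
          rw [← Ō.valuation_le_one_iff, map_div₀]
          exact div_le_one_of_le₀ (hmin' i) zero_le
      have hSqT : Sq n ≤ T := fun z hz => by rw [hTdef]; exact Subring.subset_closure (Or.inl hz)
      set Rnew : Subring F := locAtCentre T Ō with hRnewdef
      have hψrange : Set.range ψ = (Sq n : Set F) := by rw [← hrange]; rfl
      have hrangeR : (Φ.comp (hτ.stalkEmb x'')).range = Rnew := by
        rw [hrange'', hRnewdef, hTdef, hψrange]
      -- `f / ψ(c'₀) ∈ T`
      have hfT : f / ψ (c' 0) ∈ T := by
        have hfgC' : fg ∈ Ideal.span (Set.range c') := by rw [hc'span, ← hcspan]; exact hfgC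
        obtain ⟨a, ha⟩ := Ideal.mem_span_range_iff_exists_fun.mp hfgC'
        have h1 : f = ∑ j, ψ (a j) * ψ (c' j) := by
          rw [← hψfg, ← ha, map_sum]
          simp_rw [map_mul]
        have h2 : f / ψ (c' 0) = ∑ j, ψ (a j) * (ψ (c' j) / ψ (c' 0)) := by
          rw [h1, Finset.sum_div]
          simp_rw [mul_div_assoc]
        rw [h2]
        refine Subring.sum_mem _ fun j _ => Subring.mul_mem _ (hSqT (hrange ▸ ⟨a j, rfl⟩)) ?_
        rw [hTdef]
        exact Subring.subset_closure (Or.inr ⟨j, rfl⟩)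
      -- the ring isomorphism `𝒪_{Z',x} ≃ Sq n` and the transported centre family
      haveI hSqnloc : IsLocalRing (Sq n) := isLocalRing_of_range_eq ψ (Sq n) hrange
      let eψ : Z'.presheaf.stalk x ≃+* Sq n :=
        (RingEquiv.ofBijective ψ.rangeRestrict
          ⟨fun a b hab => hψ (congrArg Subtype.val hab), ψ.rangeRestrict_surjective⟩).trans (RingEquiv.subringCongr hrange)
      have heψ : ∀ a, ((eψ a : Sq n) : F) = ψ a := fun a => rfl
      have hc'' : IsRsopPart (eψ ∘ c') := hc'.map_ringEquiv eψ
      -- the new chain data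
      let zbn : ℕ → F := fun j => if hj : j < r' + 1 then ψ (c' ⟨j, hj⟩) else 0
      have hzbn : ∀ j : Fin (r' + 1), zbn j = ψ (c' j) := fun j => by
        change (if hj : (j : ℕ) < r' + 1 then ψ (c' ⟨j, hj⟩) else 0) = _
        rw [dif_pos j.2]
      have hzbn0 : zbn 0 = ψ (c' 0) := hzbn 0
      let Sq' : ℕ → Subring F := Function.update Sq (n + 1) Rnew
      let s' : ℕ → ℕ := Function.update s n r'
      let zb' : ℕ → ℕ → F := Function.update zb n zbn
      have hSq'_of_le : ∀ i ≤ n, Sq' i = Sq i := fun i hi =>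
        Function.update_of_ne (Nat.ne_of_lt (Nat.lt_succ_of_le hi)) _ _
      have hSq'n1 : Sq' (n + 1) = Rnew := Function.update_self _ _ _
      have hs'_of_lt : ∀ i < n, s' i = s i := fun i hi => Function.update_of_ne (Nat.ne_of_lt hi) _ _
      have hs'n : s' n = r' := Function.update_self _ _ _
      have hzb'_of_lt : ∀ i < n, zb' i = zb i := fun i hi => Function.update_of_ne (Nat.ne_of_lt hi) _ _
      have hzb'n : zb' n = zbn := Function.update_self _ _ _
      refine ⟨hint'', hnoeth'', hreg'', x'', Φ.comp (hτ.stalkEmb x''), Φ.injective.comp (hτ.stalkEmb_injective x''),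
        hcompat'' x'' hx'', n + 1, Sq', s', zb', ?_, ?_, ?_, ?_, ?_, ?_, ?_, ?_⟩
      · rw [hSq'_of_le 0 (Nat.zero_le n)]; exact hS0
      · rw [hSq'n1]; exact hrangeR
      · intro i hi
        rcases Nat.lt_or_ge i (n + 1) with hlt | hge
        · rw [hSq'_of_le i (Nat.lt_succ_iff.mp hlt)]; exact hdomi i (Nat.lt_succ_iff.mp hlt)
        · obtain rfl : i = n + 1 := le_antisymm hi hge
          rw [hSq'n1, hRnewdef]
          exact ⟨locAtCentre_le hTŌ, locAtCentre_locAtCentre T Ō⟩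
      · intro i hi
        rcases Nat.lt_or_ge i n with hlt | hge
        · rw [hSq'_of_le i hlt.le, hs'_of_lt i hlt, hzb'_of_lt i hlt]; exact hrsop i hlt
        · obtain rfl : i = n := le_antisymm (Nat.lt_succ_iff.mp hi) hge
          rw [hSq'_of_le i le_rfl, hs'n, hzb'n]
          exact ⟨hSqnloc, eψ ∘ c', hc'', fun j => by rw [hzbn j]; exact heψ (c' j)⟩
      · intro i hi
        rcases Nat.lt_or_ge i n with hlt | hge
        · rw [hzb'_of_lt i hlt]; exact hzb0 i hlt
        · obtain rfl : i = n := le_antisymm (Nat.lt_succ_iff.mp hi) hge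
          rw [hzb'n, hzbn0]
          exact hdom _ (hc'.mem_maximalIdeal 0)
      · intro i hi j hj
        rcases Nat.lt_or_ge i n with hlt | hge
        · rw [hzb'_of_lt i hlt]; exact hmin i hlt j ((hs'_of_lt i hlt) ▸ hj)
        · obtain rfl : i = n := le_antisymm (Nat.lt_succ_iff.mp hi) hge
          rw [hs'n] at hj
          rw [hzb'n, hzbn0, hzbn ⟨j, Nat.lt_succ_of_le hj⟩]
          exact hmin' _
      · intro i hi
        rcases Nat.lt_or_ge i n with hlt | hge
        · rw [hSq'_of_le (i + 1) hlt, hSq'_of_le i hlt.le, hs'_of_lt i hlt, hzb'_of_lt i hlt]; exact hstep i hlt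
        · obtain rfl : i = n := le_antisymm (Nat.lt_succ_iff.mp hi) hge
          have hfun : (fun l : Fin r' => zbn (l.succ : Fin (r' + 1)) / zbn 0) = fun l : Fin r' => ψ (c' l.succ) / ψ (c' 0) := by
            funext l
            rw [hzbn0, hzbn l.succ]
          rw [hSq'n1, hSq'_of_le i le_rfl, hs'n, hzb'n, hRnewdef, hTeq, ← hfun]
      · intro i hi
        rcases Nat.lt_or_ge i n with hlt | hge
        · rw [hSq'_of_le (i + 1) hlt, hzb'_of_lt i hlt]; exact hf i hlt
        · obtain rfl : i = n := le_antisymm (Nat.lt_succ_iff.mp hi) hge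
          rw [hSq'n1, hzb'n, hzbn0, hRnewdef]
          exact le_locAtCentre T Ō hfT
    · /- OFF THE CENTRE: the local ring is unchanged -/
      have hJ : stalkIdeal C x = ⊤ := stalkIdeal_eq_top_of_not_mem_support hxC
      obtain ⟨x'', hx'', hrange''⟩ :=
        hτ.exists_point_range_eq_locAtCentre_of_stalkIdeal_eq_top Ō x hJ Φ ψ hΦψ hRO hdom
      have hCne : C ≠ ⊥ := by
        rintro rfl
        apply hxC
        rw [Scheme.IdealSheafData.support_bot]
        trivial
      haveI hint'' : IsIntegral Z'' := hτ.isIntegral hCne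
      haveI : IsProper τ := hτ.isProper
      have hnoeth'' : IsLocallyNoetherian Z'' := LocallyOfFiniteType.isLocallyNoetherian τ
      have hreg'' : Scheme.IsRegular Z'' := hτ.isRegular_of_isRegular_subscheme hreg hC
      refine ⟨hint'', hnoeth'', hreg'', x'', Φ.comp (hτ.stalkEmb x''), Φ.injective.comp (hτ.stalkEmb_injective x''),
        hcompat'' x'' hx'', n, Sq, s, zb, hS0, ?_, hdomi, hrsop, hzb0, hmin, hstep, hf⟩
      rw [hrange'', hrange, hSqn.2]

end Summit.ResolutionOfSingularities.ResolutionOfSingularities.Theorems.RadicialJung.CleanModels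

end
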